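import Summits.MatrixMultiplication.OmegaCensus.STPPVosperSlackTwoCheckers

/-!
# ω-census (abelian STPP census): slack-2 case-C ROWS for `{(3,3,3),(3,3,4)} @ ℤ₆₁`, part 2 (kernel `decide`)

HONEST FRAMING (pub-omega census; verbatim): lottery ticket; floor = certified bounds/negative ranges.
Census STRUCTURE (seat pub-omega-stpp-1 gen 32, 2026-08-28), family (b2).  Rows of the slack-2 partition law, case (C) (both pairs one above
Cauchy–Davenport; Hamidoune–Rødseth shapes), for the leaf `{(3,3,3),(3,3,4)}` of `ℤ/61`, reading block `i = (4,3,3)`, other block `(3,3,3)`: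
`caseCDeadQP 61 3 9 9 3 3 3 Q P = true` for `Q = [0,3] ∖ 2` and every `P` among entries `lo ≤ · < hi` of `pShapesC 61 4` (240 shapes
`d·([0,4] ∖ {h′})`); python ×1 = Lean `#eval` statistics of the whole case: 13 272 tilings / 78 660 / 58 464 / 204 / 480 configurations / 0 realisations.
COMPUTATIONAL (`decide +kernel`, ≈ 10–40 s per chunk).  The soundness of the case-C checker is the successor's item (`STPPVosperSlackTwoCheckersC.lean`
has its control flow).  Nothing here is progress on `ω`.

References: H. Cohn, R. Kleinberg, B. Szegedy, C. Umans, FOCS 2005 (arXiv:math/0511460), Def. 5.1; Y. O. Hamidoune, Ø. J. Rødseth, Acta Arith. 92 (2000).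
-/

namespace Summit.MatrixMultiplication.OmegaCensus.CubeNB.S2

/-- Case-C row, `Q = [0, 1, 3]` (hole 2), `P`-shapes `0 ≤ · < 40`. [cite: CohnKleinbergSzegedyUmans2005, Def. 5.1] -/
theorem rowC333_h2_0_40 : ((((pShapesC 61 4).drop 0).take 40).all fun P => caseCDeadQP 61 3 9 9 3 3 3 [0, 1, 3] P) = true := by
  decide +kernel

/-- Case-C row, `Q = [0, 1, 3]` (hole 2), `P`-shapes `40 ≤ · < 80`. [cite: CohnKleinbergSzegedyUmans2005, Def. 5.1] -/
theorem rowC333_h2_40_80 : ((((pShapesC 61 4).drop 40).take 40).all fun P => caseCDeadQP 61 3 9 9 3 3 3 [0, 1, 3] P) = true := by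
  decide +kernel

/-- Case-C row, `Q = [0, 1, 3]` (hole 2), `P`-shapes `80 ≤ · < 120`. [cite: CohnKleinbergSzegedyUmans2005, Def. 5.1] -/
theorem rowC333_h2_80_120 : ((((pShapesC 61 4).drop 80).take 40).all fun P => caseCDeadQP 61 3 9 9 3 3 3 [0, 1, 3] P) = true := by
  decide +kernel

/-- Case-C row, `Q = [0, 1, 3]` (hole 2), `P`-shapes `120 ≤ · < 160`. [cite: CohnKleinbergSzegedyUmans2005, Def. 5.1] -/
theorem rowC333_h2_120_160 : ((((pShapesC 61 4).drop 120).take 40).all fun P => caseCDeadQP 61 3 9 9 3 3 3 [0, 1, 3] P) = true := by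
  decide +kernel

/-- Case-C row, `Q = [0, 1, 3]` (hole 2), `P`-shapes `160 ≤ · < 200`. [cite: CohnKleinbergSzegedyUmans2005, Def. 5.1] -/
theorem rowC333_h2_160_200 : ((((pShapesC 61 4).drop 160).take 40).all fun P => caseCDeadQP 61 3 9 9 3 3 3 [0, 1, 3] P) = true := by
  decide +kernel

/-- Case-C row, `Q = [0, 1, 3]` (hole 2), `P`-shapes `200 ≤ · < 240`. [cite: CohnKleinbergSzegedyUmans2005, Def. 5.1] -/
theorem rowC333_h2_200_240 : ((((pShapesC 61 4).drop 200).take 40).all fun P => caseCDeadQP 61 3 9 9 3 3 3 [0, 1, 3] P) = true := by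
  decide +kernel

end Summit.MatrixMultiplication.OmegaCensus.CubeNB.S2
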